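import Literature.AlgebraicGeometry.AbelianSchemes.AbelianSchemeIsLambdaOfAtConjugateTransport
import HarnessLib

/-!
# `λ̄ = Λ(𝒪(Θ))` transports along an ARBITRARY pull-back square of abelian schemes with its Poincaré clause

Layer `Literature/AlgebraicGeometry/AbelianSchemes`, namespace `Literature.AlgebraicGeometry.AbelianSchemes.AbelianSchemeOver`.
THEOREMS ONLY (no definition, no named fact, no instance, no `sorry`).  Cell `hodgecm-mathlib` (D-0151), SOCKETS-F §4 (α)
capital leaf (c) (B-plan1 (g13) 18:04Z; count-neutral): the tree's `IsLambdaOfAt` base-change lemmas ★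
`IsLambdaOfAt.baseChange` / ★ `IsLambdaOfAt.of_baseChange` (`AbelianSchemeIsLambdaOfAtBaseChange`) are stated for the CHOSEN
base change `A ×_S S′` and its fibre identification `fibreBaseChangeIso`; this file proves them for ANY pair of abelian
schemes `A′/S′`, `A/S` with dual pairs `D′ = (Â′, 𝒫′)`, `D = (Â, 𝒫)`, morphisms `λ′ : A′ → Â′`, `λ : A → Â`, related over
`f : S′ → S` by maps `G : A′ → A`, `Ĝ : Â′ → Â` carrying the POINCARÉ CLAUSE `(G ×_f Ĝ)^*𝒫 ≅ 𝒫′` and the `λ`-CLAUSE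
`λ′ ≫ Ĝ = G ≫ λ` (the two clauses of ★ `PolarizedAbelianSchemeWithLevel.IsBaseChangeVia`,
[MumfordFogartyKirwan1994] Def. 7.2), and ANY isomorphism of fibre abelian varieties `e : A′_{s′} ≅ A_{s′ ≫ f}` lying over
`G` (`he : e ≫ pr_A = pr_{A′} ≫ G` — the cell's «map as a variable» convention; for a cartesian `G` such an `e` is the
comparison of fibre products).  HC_CM is proved only modulo the 7 printed citations until rung 0 closes.

* §E **`IsLambdaOfAt.transport₂`** — the two-scheme ENGINE generalising ★ `IsLambdaOfAt.transport` (same `A` on both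
  sides): a dominant `φ : A′_{s′} → A_s` reading a map of points `π₀`, intertwining the translations, and carrying
  MODULE isomorphisms `𝒫′|_{A′_{s′} × {λ̄′(P′)}} ≅ φ^*(𝒫|_{A_s × {λ̄(π₀P′)}})` for all `P′`, transports
  [MumfordFogartyKirwan1994, Def. 6.2] «`Λ(L)(x) = T_x^*L ⊗ L⁻¹`» from `(A, s, Θ)` to `(A′, s′, φ^*Θ)`.  Proof = the ★
  engine's: both sides of Mumford's identity at `P′` are rank-one modules on the integral `A′_{s′}` with class
  `φ^*(t_{π₀P′}^*[Θ]·[Θ]⁻¹) = t_{P′}^*[φ^*Θ]·[φ^*Θ]⁻¹` (★ `detClass_translationPullback_tensor_dual`, ★ `cechClass_pullback`),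
  hence isomorphic (★ `nonempty_iso_iff_detClass_eq`, [Hartshorne1977, III Ex. 4.5]).
* §S the SLICE SQUARE of a pull-back square: `slice′_{λ̄′(P′)} ≫ (G ×_f Ĝ) = e ≫ slice_{λ̄(e P′)}`
  (`sliceAt_comp_pullbackMap_eq_of_fibreIso`), whence the module isomorphisms of §E from the Poincaré clause
  (`nonempty_pullback_sliceAt_iso_of_poincare`) and, through `e⁻¹`, their mirror images
  (`nonempty_pullback_sliceAt_iso_of_poincare_symm`).
* §T **`IsLambdaOfAt.of_isBaseChangeVia_fibreIso`** — `λ̄ = Λ(𝒪(Θ))` at `s′ ≫ f` ⟹ `λ̄′ = Λ(𝒪(e^*Θ))` at `s′`;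
  **`IsLambdaOfAt.of_isBaseChangeVia_fibreIso_symm`** — `λ̄′ = Λ(𝒪(Θ′))` at `s′` ⟹ `λ̄ = Λ(𝒪((e⁻¹)^*Θ′))` at `s′ ≫ f`,
  with the ampleness clause: **`transfer_of_isBaseChangeVia_fibreIso`** = the `hpol` hypothesis of ★ (T2)
  `LevelStructure.IsSymplecticLiftable.of_fibreIso` for ARBITRARY pull-back squares (★ `Polarization.transfer_baseChange`
  was the chosen-base-change case); §T′ the same three for the tree's triples `PolarizedAbelianSchemeWithLevel.IsBaseChangeVia`.

## References
* [MumfordFogartyKirwan1994] D. Mumford, J. Fogarty, F. Kirwan, *Geometric Invariant Theory* (3rd ed., 1994), Ch. 6 §2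
  Definition 6.2–6.3 (p. 120); Ch. 7 §2 Definition 7.2 (p. 129).
* [Lan2013PELCompactifications] K.-W. Lan, *Arithmetic compactifications of PEL-type Shimura varieties* (2013), §1.3.6
  Lemma 1.3.6.6 (pp. 81–82).
* [Hartshorne1977] R. Hartshorne, *Algebraic Geometry* (1977), II Ex. 6.8; III Ex. 4.5.
-/

noncomputable section

open CategoryTheory CategoryTheory.Limits AlgebraicGeometry MonoidalCategory

universe u

namespace Literature.AlgebraicGeometry.AbelianSchemes

open Literature.AlgebraicGeometry.Motives Literature.AlgebraicGeometry.AbelianVarieties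
  Literature.AlgebraicGeometry.Modules
open scoped MonObj

namespace AbelianSchemeOver

/-- `f^*(g^*γ) = (f ≫ g)^*γ` in `Ȟ¹(-, 𝒪^×)` (private copy of the tree's `CechPic.pullback_comp`, through ★ `detClass_pullback`
and Mathlib `Scheme.Modules.pullbackComp`, as in the ★ parents). [cite: Hartshorne1977, II Ex. 6.8 (a)] -/
private theorem cechPic_pullback_pullback {X Y Z : Scheme.{u}} (f : X ⟶ Y) (g : Y ⟶ Z) (c₀ : CechPic Z) :
    CechPic.pullback f (CechPic.pullback g c₀) = CechPic.pullback (f ≫ g) c₀ := by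
  obtain ⟨c, rfl⟩ := CechPic.mk_surjective c₀
  have hE := c.isFiniteLocallyFree_lineBundle
  rw [← c.detClass_lineBundle, ← detClass_pullback, ← detClass_pullback, ← detClass_pullback]
  exact (detClass_eq_of_iso ((Scheme.Modules.pullbackComp f g).app (lineBundle c)).symm _ _).symm

variable {S S' : Scheme.{u}} (A : AbelianSchemeOver S) (D : A.DualPair) (lam : A.X ⟶ D.hat.X)
  (A' : AbelianSchemeOver S') (D' : A'.DualPair) (lam' : A'.X ⟶ D'.hat.X)
  {L L' : Type u} [Field L] [Field L'] {s : Spec (.of L) ⟶ S} {s' : Spec (.of L') ⟶ S'}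

/-! ### §E The two-scheme transport engine -/

section Engine

variable (φ : (A'.fibre s').toAbelianVariety.X.left ⟶ (A.fibre s).toAbelianVariety.X.left) [IsDominant φ]
  (π₀ : (A'.fibre s').toAbelianVariety.Points L' → (A.fibre s).toAbelianVariety.Points L)
  (hj : ∀ P' : (A'.fibre s').toAbelianVariety.Points L',
    Nonempty ((Scheme.Modules.pullback (A'.sliceAt s' D' lam' P')).obj D'.P ≅
      (Scheme.Modules.pullback φ).obj ((Scheme.Modules.pullback (A.sliceAt s D lam (π₀ P'))).obj D.P)))
  (hc : ∀ P' : (A'.fibre s').toAbelianVariety.Points L',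
    ((A'.fibre s').toAbelianVariety.translation P').left ≫ φ =
      φ ≫ ((A.fibre s).toAbelianVariety.translation (π₀ P')).left)

include hj hc in
/-- **TRANSPORT ENGINE (two abelian schemes).**  Let `φ : A′_{s′} → A_s` be a dominant morphism of the underlying schemes of
two fibres (of `A′/S′` at `s′`, of `A/S` at `s`), `π₀` the map it induces on points in the sense that `φ` intertwines the
translations (`t_{P′} ≫ φ = φ ≫ t_{π₀ P′}`), and suppose the Poincaré sheaves are compatible along `φ` slice by slice:
`𝒫′|_{A′_{s′} × {λ̄′(P′)}} ≅ φ^*(𝒫|_{A_s × {λ̄(π₀ P′)}})` for every `P′`.  Then `λ̄ = Λ(𝒪(Θ))` at `s`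
([MumfordFogartyKirwan1994, Def. 6.2–6.3], ★ `IsLambdaOfAt`) implies `λ̄′ = Λ(𝒪(φ^*Θ))` at `s′`: both sides of Mumford's
identity at `P′` are rank-one modules on the integral `A′_{s′}` with the same class `φ^*(t_{π₀P′}^*[Θ]·[Θ]⁻¹) =
t_{P′}^*[φ^*Θ]·[φ^*Θ]⁻¹`. [cite: MumfordFogartyKirwan1994, Ch. 6 §2 Definition 6.2–6.3 (p. 120)] [cite: Hartshorne1977, III Ex. 4.5] -/
theorem IsLambdaOfAt.transport₂ (Θ : CartierDivisor (A.fibre s).toAbelianVariety.X.left)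
    (h : A.IsLambdaOfAt s D lam Θ) : A'.IsLambdaOfAt s' D' lam' (Θ.pullback φ) := by
  intro P'
  obtain ⟨i⟩ := h (π₀ P')
  obtain ⟨j⟩ := hj P'
  have hl' : HasRank ((Scheme.Modules.pullback (A'.sliceAt s' D' lam' P')).obj D'.P) 1 := hasRank_pullback _ D'.hasRank_one
  have hl : HasRank ((Scheme.Modules.pullback (A.sliceAt s D lam (π₀ P'))).obj D.P) 1 := hasRank_pullback _ D.hasRank_one
  have hr' : HasRank (tensorObj
      ((Scheme.Modules.pullback ((A'.fibre s').toAbelianVariety.translation P').left).obj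
        (A'.lineBundleOfDivisor s' (Θ.pullback φ)))
      (Modules.dual (A'.lineBundleOfDivisor s' (Θ.pullback φ)))) 1 :=
    hasRank_tensorObj_one (hasRank_pullback _ (A'.hasRank_lineBundleOfDivisor s' _))
      (hasRank_dual (A'.hasRank_lineBundleOfDivisor s' _))
  have hr : HasRank (tensorObj
      ((Scheme.Modules.pullback ((A.fibre s).toAbelianVariety.translation (π₀ P')).left).obj
        (A.lineBundleOfDivisor s Θ))
      (Modules.dual (A.lineBundleOfDivisor s Θ))) 1 :=
    hasRank_tensorObj_one (hasRank_pullback _ (A.hasRank_lineBundleOfDivisor s _))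
      (hasRank_dual (A.hasRank_lineBundleOfDivisor s _))
  refine (nonempty_iso_iff_detClass_eq hl' hr' (HasRank.isFiniteLocallyFree' hl')
    (HasRank.isFiniteLocallyFree' hr')).2 ?_
  have lhs_eq : detClass (HasRank.isFiniteLocallyFree' hl') =
      CechPic.pullback φ (CechPic.pullback ((A.fibre s).toAbelianVariety.translation (π₀ P')).left Θ.cechClass *
        (Θ.cechClass)⁻¹) :=
    (detClass_eq_of_iso j _ ((HasRank.isFiniteLocallyFree' hl).pullback φ)).trans
      ((detClass_pullback φ (HasRank.isFiniteLocallyFree' hl)).trans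
        (congrArg (CechPic.pullback φ)
          ((detClass_eq_of_iso i _ (HasRank.isFiniteLocallyFree' hr)).trans
            (A.detClass_translationPullback_tensor_dual s Θ (π₀ P') _))))
  have mid : CechPic.pullback φ
        (CechPic.pullback ((A.fibre s).toAbelianVariety.translation (π₀ P')).left Θ.cechClass * (Θ.cechClass)⁻¹) =
      CechPic.pullback ((A'.fibre s').toAbelianVariety.translation P').left (CechPic.pullback φ Θ.cechClass) *
        (CechPic.pullback φ Θ.cechClass)⁻¹ := by
    rw [map_mul, map_inv, cechPic_pullback_pullback, cechPic_pullback_pullback, hc P']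
  have rhs_eq : detClass (HasRank.isFiniteLocallyFree' hr') =
      CechPic.pullback ((A'.fibre s').toAbelianVariety.translation P').left (CechPic.pullback φ Θ.cechClass) *
        (CechPic.pullback φ Θ.cechClass)⁻¹ := by
    rw [A'.detClass_translationPullback_tensor_dual s' (Θ.pullback φ) P' (HasRank.isFiniteLocallyFree' hr'),
      CartierDivisor.cechClass_pullback]
  exact lhs_eq.trans (mid.trans rhs_eq.symm)

end Engine

/-! ### §S The slice square of a pull-back square and the module isomorphisms it induces -/

section Square

variable (f : S' ⟶ S) (G : A'.X.left ⟶ A.X.left) (Ĝ : D'.hat.X.left ⟶ D.hat.X.left)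
  (wG : A'.X.hom ≫ f = G ≫ A.X.hom) (wĜ : D'.hat.X.hom ≫ f = Ĝ ≫ D.hat.X.hom)
  (hlam : lam'.left ≫ Ĝ = G ≫ lam.left)
  (s' : Spec (.of L) ⟶ S')
  (e : (A'.fibre s').toAbelianVariety ≅ (A.fibre (s' ≫ f)).toAbelianVariety)
  (he : AbelianVariety.Hom.toSchemeHom e.hom ≫ pullback.fst A.X.hom (s' ≫ f) = pullback.fst A'.X.hom s' ≫ G)

include he in
/-- The point of `A` under `e(P′)` is the point of `A′` under `P′`, followed by `G`. [cite: MumfordFogartyKirwan1994, Ch. 7 §2 Definition 7.2 (p. 129)] -/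
theorem fibrePointToLeft_map_fibreIso_eq (P' : (A'.fibre s').toAbelianVariety.Points L) :
    A.fibrePointToLeft (s' ≫ f) (AlgPoints.map e.hom.hom.hom.hom P') = A'.fibrePointToLeft s' P' ≫ G := by
  change (P' ≫ e.hom.hom.hom.hom).left ≫ pullback.fst A.X.hom (s' ≫ f) = _
  rw [Over.comp_left, Category.assoc]
  exact (congrArg (fun x => P'.left ≫ x) he).trans (Category.assoc _ _ _).symm

include he hlam in
/-- **`λ̄(e P′) = λ̄′(P′) ≫ Ĝ`**: the value of `λ` at the transported point is the value of `λ′` pushed along `Ĝ`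
(`λ′ ≫ Ĝ = G ≫ λ`). [cite: MumfordFogartyKirwan1994, Ch. 6 §2 Definition 6.3 (p. 120) and Ch. 7 §2 Definition 7.2 (p. 129)] -/
theorem valueAt_map_fibreIso_eq (P' : (A'.fibre s').toAbelianVariety.Points L) :
    A.valueAt (s' ≫ f) D lam (AlgPoints.map e.hom.hom.hom.hom P') = A'.valueAt s' D' lam' P' ≫ Ĝ :=
  calc A.valueAt (s' ≫ f) D lam (AlgPoints.map e.hom.hom.hom.hom P')
      = A.fibrePointToLeft (s' ≫ f) (AlgPoints.map e.hom.hom.hom.hom P') ≫ lam.left := rfl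
    _ = (A'.fibrePointToLeft s' P' ≫ G) ≫ lam.left := by rw [A.fibrePointToLeft_map_fibreIso_eq A' f G s' e he P']
    _ = A'.fibrePointToLeft s' P' ≫ (G ≫ lam.left) := Category.assoc _ _ _
    _ = A'.fibrePointToLeft s' P' ≫ (lam'.left ≫ Ĝ) := by rw [hlam]
    _ = (A'.fibrePointToLeft s' P' ≫ lam'.left) ≫ Ĝ := (Category.assoc _ _ _).symm
    _ = A'.valueAt s' D' lam' P' ≫ Ĝ := rfl

include he hlam in
/-- **THE SLICE SQUARE of a pull-back square**: `slice′_{λ̄′(P′)} ≫ (G ×_f Ĝ) = e ≫ slice_{λ̄(e P′)}` as morphisms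
`A′_{s′} → A ×_S Â` (first components `pr_{A′} ≫ G = e ≫ pr_A`, second components `λ̄′(P′) ≫ Ĝ = λ̄(e P′)` over `Spec L`).
[cite: MumfordFogartyKirwan1994, Ch. 6 §2 Definition 6.2 (p. 120)] [cite: MumfordFogartyKirwan1994, Ch. 7 §2 Definition 7.2 (p. 129)] -/
theorem sliceAt_comp_pullbackMap_eq_of_fibreIso (P' : (A'.fibre s').toAbelianVariety.Points L) :
    A'.sliceAt s' D' lam' P' ≫ pullback.map A'.X.hom D'.hat.X.hom A.X.hom D.hat.X.hom G Ĝ f wG wĜ =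
      AbelianVariety.Hom.toSchemeHom e.hom ≫ A.sliceAt (s' ≫ f) D lam (AlgPoints.map e.hom.hom.hom.hom P') := by
  have hsnd : AbelianVariety.Hom.toSchemeHom e.hom ≫ pullback.snd A.X.hom (s' ≫ f) = pullback.snd A'.X.hom s' :=
    Over.w e.hom.hom.hom.hom
  apply pullback.hom_ext
  · calc (A'.sliceAt s' D' lam' P' ≫ pullback.map A'.X.hom D'.hat.X.hom A.X.hom D.hat.X.hom G Ĝ f wG wĜ) ≫
          pullback.fst A.X.hom D.hat.X.hom
        = A'.sliceAt s' D' lam' P' ≫ (pullback.map A'.X.hom D'.hat.X.hom A.X.hom D.hat.X.hom G Ĝ f wG wĜ ≫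
            pullback.fst A.X.hom D.hat.X.hom) := Category.assoc _ _ _
      _ = A'.sliceAt s' D' lam' P' ≫ (pullback.fst A'.X.hom D'.hat.X.hom ≫ G) := by rw [pullback.lift_fst]
      _ = (A'.sliceAt s' D' lam' P' ≫ pullback.fst A'.X.hom D'.hat.X.hom) ≫ G := (Category.assoc _ _ _).symm
      _ = pullback.fst A'.X.hom s' ≫ G := by rw [A'.sliceAt_fst]
      _ = AbelianVariety.Hom.toSchemeHom e.hom ≫ pullback.fst A.X.hom (s' ≫ f) := he.symm
      _ = AbelianVariety.Hom.toSchemeHom e.hom ≫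
            (A.sliceAt (s' ≫ f) D lam (AlgPoints.map e.hom.hom.hom.hom P') ≫ pullback.fst A.X.hom D.hat.X.hom) :=
          whisker_eq _ (A.sliceAt_fst (s' ≫ f) D lam _).symm
      _ = (AbelianVariety.Hom.toSchemeHom e.hom ≫ A.sliceAt (s' ≫ f) D lam (AlgPoints.map e.hom.hom.hom.hom P')) ≫
            pullback.fst A.X.hom D.hat.X.hom := (Category.assoc _ _ _).symm
  · calc (A'.sliceAt s' D' lam' P' ≫ pullback.map A'.X.hom D'.hat.X.hom A.X.hom D.hat.X.hom G Ĝ f wG wĜ) ≫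
          pullback.snd A.X.hom D.hat.X.hom
        = A'.sliceAt s' D' lam' P' ≫ (pullback.map A'.X.hom D'.hat.X.hom A.X.hom D.hat.X.hom G Ĝ f wG wĜ ≫
            pullback.snd A.X.hom D.hat.X.hom) := Category.assoc _ _ _
      _ = A'.sliceAt s' D' lam' P' ≫ (pullback.snd A'.X.hom D'.hat.X.hom ≫ Ĝ) := by rw [pullback.lift_snd]
      _ = (A'.sliceAt s' D' lam' P' ≫ pullback.snd A'.X.hom D'.hat.X.hom) ≫ Ĝ := (Category.assoc _ _ _).symm
      _ = (pullback.snd A'.X.hom s' ≫ A'.valueAt s' D' lam' P') ≫ Ĝ := by rw [A'.sliceAt_snd]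
      _ = pullback.snd A'.X.hom s' ≫ (A'.valueAt s' D' lam' P' ≫ Ĝ) := Category.assoc _ _ _
      _ = pullback.snd A'.X.hom s' ≫ A.valueAt (s' ≫ f) D lam (AlgPoints.map e.hom.hom.hom.hom P') :=
          whisker_eq _ (A.valueAt_map_fibreIso_eq D lam A' D' lam' f G Ĝ hlam s' e he P').symm
      _ = (AbelianVariety.Hom.toSchemeHom e.hom ≫ pullback.snd A.X.hom (s' ≫ f)) ≫
            A.valueAt (s' ≫ f) D lam (AlgPoints.map e.hom.hom.hom.hom P') := eq_whisker hsnd.symm _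
      _ = AbelianVariety.Hom.toSchemeHom e.hom ≫
            (pullback.snd A.X.hom (s' ≫ f) ≫ A.valueAt (s' ≫ f) D lam (AlgPoints.map e.hom.hom.hom.hom P')) :=
          Category.assoc _ _ _
      _ = AbelianVariety.Hom.toSchemeHom e.hom ≫
            (A.sliceAt (s' ≫ f) D lam (AlgPoints.map e.hom.hom.hom.hom P') ≫ pullback.snd A.X.hom D.hat.X.hom) :=
          whisker_eq _ (A.sliceAt_snd (s' ≫ f) D lam _).symm
      _ = (AbelianVariety.Hom.toSchemeHom e.hom ≫ A.sliceAt (s' ≫ f) D lam (AlgPoints.map e.hom.hom.hom.hom P')) ≫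
            pullback.snd A.X.hom D.hat.X.hom := (Category.assoc _ _ _).symm

include he hlam in
/-- **The Poincaré clause, slice by slice**: `𝒫′|_{A′_{s′} × {λ̄′(P′)}} ≅ e^*(𝒫|_{A_{s′≫f} × {λ̄(e P′)}})` — from
`(G ×_f Ĝ)^*𝒫 ≅ 𝒫′` and the slice square (Mathlib `Scheme.Modules.pullbackComp`/`pullbackCongr`).
[cite: MumfordFogartyKirwan1994, Ch. 6 §2 Definition 6.2 (p. 120) and Ch. 7 §2 Definition 7.2 (p. 129)] -/
theorem nonempty_pullback_sliceAt_iso_of_poincare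
    (eP : (Scheme.Modules.pullback (pullback.map A'.X.hom D'.hat.X.hom A.X.hom D.hat.X.hom G Ĝ f wG wĜ)).obj D.P ≅ D'.P)
    (P' : (A'.fibre s').toAbelianVariety.Points L) :
    Nonempty ((Scheme.Modules.pullback (A'.sliceAt s' D' lam' P')).obj D'.P ≅
      (Scheme.Modules.pullback (AbelianVariety.Hom.toSchemeHom e.hom)).obj
        ((Scheme.Modules.pullback (A.sliceAt (s' ≫ f) D lam (AlgPoints.map e.hom.hom.hom.hom P'))).obj D.P)) :=
  ⟨(Scheme.Modules.pullback (A'.sliceAt s' D' lam' P')).mapIso eP.symm ≪≫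
    (Scheme.Modules.pullbackComp (A'.sliceAt s' D' lam' P') _).app D.P ≪≫
    (Scheme.Modules.pullbackCongr
      (A.sliceAt_comp_pullbackMap_eq_of_fibreIso D lam A' D' lam' f G Ĝ wG wĜ hlam s' e he P')).app D.P ≪≫
    ((Scheme.Modules.pullbackComp (AbelianVariety.Hom.toSchemeHom e.hom)
      (A.sliceAt (s' ≫ f) D lam (AlgPoints.map e.hom.hom.hom.hom P'))).app D.P).symm⟩

/-- `e⁻¹ ≫ e = 𝟙` on underlying scheme morphisms. [folklore] -/
private theorem toSchemeHom_inv_comp_hom :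
    AbelianVariety.Hom.toSchemeHom e.inv ≫ AbelianVariety.Hom.toSchemeHom e.hom = 𝟙 _ := by
  change AbelianVariety.Hom.toSchemeHom (e.inv ≫ e.hom) = _
  rw [e.inv_hom_id]
  rfl

/-- `e ≫ e⁻¹ = 𝟙` on underlying scheme morphisms. [folklore] -/
private theorem toSchemeHom_hom_comp_inv :
    AbelianVariety.Hom.toSchemeHom e.hom ≫ AbelianVariety.Hom.toSchemeHom e.inv = 𝟙 _ := by
  change AbelianVariety.Hom.toSchemeHom (e.hom ≫ e.inv) = _
  rw [e.hom_inv_id]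
  rfl

/-- `e (e⁻¹ Q) = Q` on points. [folklore] -/
private theorem map_hom_map_inv (Q : (A.fibre (s' ≫ f)).toAbelianVariety.Points L) :
    AlgPoints.map e.hom.hom.hom.hom (AlgPoints.map e.inv.hom.hom.hom Q) = Q := by
  rw [← AlgPoints.map_comp_apply]
  change AlgPoints.map (e.inv ≫ e.hom).hom.hom.hom Q = Q
  rw [e.inv_hom_id]
  exact AlgPoints.map_id_apply Q

include he hlam in
/-- **The mirror image through `e⁻¹`**: `𝒫|_{A_{s′≫f} × {λ̄(Q)}} ≅ (e⁻¹)^*(𝒫′|_{A′_{s′} × {λ̄′(e⁻¹ Q)}})` for every point `Q` of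
`A_{s′ ≫ f}` (apply `(e⁻¹)^*` to the slice isomorphism at `P′ = e⁻¹ Q` and re-bracket `(e⁻¹)^*e^* = 𝟙^*`).
[cite: MumfordFogartyKirwan1994, Ch. 6 §2 Definition 6.2 (p. 120) and Ch. 7 §2 Definition 7.2 (p. 129)] -/
theorem nonempty_pullback_sliceAt_iso_of_poincare_symm
    (eP : (Scheme.Modules.pullback (pullback.map A'.X.hom D'.hat.X.hom A.X.hom D.hat.X.hom G Ĝ f wG wĜ)).obj D.P ≅ D'.P)
    (Q : (A.fibre (s' ≫ f)).toAbelianVariety.Points L) :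
    Nonempty ((Scheme.Modules.pullback (A.sliceAt (s' ≫ f) D lam Q)).obj D.P ≅
      (Scheme.Modules.pullback (AbelianVariety.Hom.toSchemeHom e.inv)).obj
        ((Scheme.Modules.pullback (A'.sliceAt s' D' lam' (AlgPoints.map e.inv.hom.hom.hom Q))).obj D'.P)) := by
  obtain ⟨j⟩ := A.nonempty_pullback_sliceAt_iso_of_poincare D lam A' D' lam' f G Ĝ wG wĜ hlam s' e he eP
    (AlgPoints.map e.inv.hom.hom.hom Q)
  have hQ : A.sliceAt (s' ≫ f) D lam (AlgPoints.map e.hom.hom.hom.hom (AlgPoints.map e.inv.hom.hom.hom Q)) =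
      A.sliceAt (s' ≫ f) D lam Q := by
    rw [A.map_hom_map_inv A' f s' e Q]
  -- `slice_Q^*𝒫 ≅ slice_{e e⁻¹ Q}^*𝒫 ≅ (𝟙)^*(…) ≅ (e⁻¹ ≫ e)^*(…) ≅ (e⁻¹)^* e^*(…) ≅ (e⁻¹)^* slice′^*𝒫′`
  let M : ((A.fibre (s' ≫ f)).toAbelianVariety.X.left).Modules :=
    (Scheme.Modules.pullback (A.sliceAt (s' ≫ f) D lam
      (AlgPoints.map e.hom.hom.hom.hom (AlgPoints.map e.inv.hom.hom.hom Q)))).obj D.P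
  have i1 : (Scheme.Modules.pullback (A.sliceAt (s' ≫ f) D lam Q)).obj D.P ≅ M :=
    (Scheme.Modules.pullbackCongr hQ.symm).app D.P
  have i2 : M ≅ (Scheme.Modules.pullback (𝟙 _)).obj M := ((Scheme.Modules.pullbackId _).app M).symm
  have i3 : (Scheme.Modules.pullback (𝟙 _)).obj M ≅
      (Scheme.Modules.pullback
        (AbelianVariety.Hom.toSchemeHom e.inv ≫ AbelianVariety.Hom.toSchemeHom e.hom)).obj M :=
    (Scheme.Modules.pullbackCongr (A.toSchemeHom_inv_comp_hom A' f s' e).symm).app M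
  have i4 : (Scheme.Modules.pullback
        (AbelianVariety.Hom.toSchemeHom e.inv ≫ AbelianVariety.Hom.toSchemeHom e.hom)).obj M ≅
      (Scheme.Modules.pullback (AbelianVariety.Hom.toSchemeHom e.inv)).obj
        ((Scheme.Modules.pullback (AbelianVariety.Hom.toSchemeHom e.hom)).obj M) :=
    ((Scheme.Modules.pullbackComp (AbelianVariety.Hom.toSchemeHom e.inv) (AbelianVariety.Hom.toSchemeHom e.hom)).app M).symm
  have i5 : (Scheme.Modules.pullback (AbelianVariety.Hom.toSchemeHom e.inv)).obj
        ((Scheme.Modules.pullback (AbelianVariety.Hom.toSchemeHom e.hom)).obj M) ≅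
      (Scheme.Modules.pullback (AbelianVariety.Hom.toSchemeHom e.inv)).obj
        ((Scheme.Modules.pullback (A'.sliceAt s' D' lam' (AlgPoints.map e.inv.hom.hom.hom Q))).obj D'.P) :=
    (Scheme.Modules.pullback (AbelianVariety.Hom.toSchemeHom e.inv)).mapIso j.symm
  exact ⟨i1 ≪≫ i2 ≪≫ i3 ≪≫ i4 ≪≫ i5⟩

/-! ### §T The transport theorems for a pull-back square -/

include he hlam in
/-- **`λ̄ = Λ(𝒪(Θ))` at `s′ ≫ f` implies `λ̄′ = Λ(𝒪(e^*Θ))` at `s′`** along a pull-back square with its Poincaré clause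
`(G ×_f Ĝ)^*𝒫 ≅ 𝒫′` and `λ′ ≫ Ĝ = G ≫ λ`, for ANY fibre isomorphism `e` over `G` (generalises ★ `IsLambdaOfAt.baseChange`,
the case `A′ = A ×_S S′`, `e = fibreBaseChangeIso`). [cite: MumfordFogartyKirwan1994, Ch. 6 §2 Definition 6.2–6.3 (p. 120)]
[cite: MumfordFogartyKirwan1994, Ch. 7 §2 Definition 7.2 (p. 129)] -/
theorem IsLambdaOfAt.of_isBaseChangeVia_fibreIso
    (eP : (Scheme.Modules.pullback (pullback.map A'.X.hom D'.hat.X.hom A.X.hom D.hat.X.hom G Ĝ f wG wĜ)).obj D.P ≅ D'.P)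
    (Θ : CartierDivisor (A.fibre (s' ≫ f)).toAbelianVariety.X.left) (h : A.IsLambdaOfAt (s' ≫ f) D lam Θ) :
    haveI := AbelianVariety.isDominant_toSchemeHom_iso_hom e
    A'.IsLambdaOfAt s' D' lam' (Θ.pullback (AbelianVariety.Hom.toSchemeHom e.hom)) :=
  haveI := AbelianVariety.isDominant_toSchemeHom_iso_hom e
  IsLambdaOfAt.transport₂ A D lam A' D' lam' (AbelianVariety.Hom.toSchemeHom e.hom)
    (AlgPoints.map e.hom.hom.hom.hom)
    (A.nonempty_pullback_sliceAt_iso_of_poincare D lam A' D' lam' f G Ĝ wG wĜ hlam s' e he eP)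
    (fun P' => AbelianVariety.translation_left_comp_toSchemeHom e.hom P') Θ h

include he hlam in
/-- **Conversely, `λ̄′ = Λ(𝒪(Θ′))` at `s′` implies `λ̄ = Λ(𝒪((e⁻¹)^*Θ′))` at `s′ ≫ f`** (generalises ★
`IsLambdaOfAt.of_baseChange`): the engine along `e⁻¹` with the mirrored slice isomorphisms.
[cite: MumfordFogartyKirwan1994, Ch. 6 §2 Definition 6.2–6.3 (p. 120)] [cite: MumfordFogartyKirwan1994, Ch. 7 §2 Definition 7.2 (p. 129)] -/
theorem IsLambdaOfAt.of_isBaseChangeVia_fibreIso_symm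
    (eP : (Scheme.Modules.pullback (pullback.map A'.X.hom D'.hat.X.hom A.X.hom D.hat.X.hom G Ĝ f wG wĜ)).obj D.P ≅ D'.P)
    (Θ' : CartierDivisor (A'.fibre s').toAbelianVariety.X.left) (h' : A'.IsLambdaOfAt s' D' lam' Θ') :
    haveI : IsDominant (AbelianVariety.Hom.toSchemeHom e.inv) := AbelianVariety.isDominant_toSchemeHom_iso_hom e.symm
    A.IsLambdaOfAt (s' ≫ f) D lam (Θ'.pullback (AbelianVariety.Hom.toSchemeHom e.inv)) :=
  haveI : IsDominant (AbelianVariety.Hom.toSchemeHom e.inv) := AbelianVariety.isDominant_toSchemeHom_iso_hom e.symm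
  IsLambdaOfAt.transport₂ A' D' lam' A D lam (AbelianVariety.Hom.toSchemeHom e.inv)
    (AlgPoints.map e.inv.hom.hom.hom)
    (A.nonempty_pullback_sliceAt_iso_of_poincare_symm D lam A' D' lam' f G Ĝ wG wĜ hlam s' e he eP)
    (fun Q => AbelianVariety.translation_left_comp_toSchemeHom e.inv Q) Θ' h'

include he hlam in
/-- **The polarisation transfer `hpol` of ★ (T2) `LevelStructure.IsSymplecticLiftable.of_fibreIso` for an ARBITRARY
pull-back square**: every ample `Θ′` with `λ̄′ = Λ(𝒪(Θ′))` at `s′` pulls back along `e⁻¹` to an ample divisor with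
`λ̄ = Λ(𝒪((e⁻¹)^*Θ′))` at `s′ ≫ f` (ampleness along an isomorphism: Mathlib `IsAffineHom` of an iso, ★ `IsAmple.pullback`).
[cite: Lan2013PELCompactifications, §1.3.6 Lemma 1.3.6.6 (pp. 81–82)] [cite: MumfordFogartyKirwan1994, Ch. 7 §2 Definition 7.2 (p. 129)] -/
theorem transfer_of_isBaseChangeVia_fibreIso
    (eP : (Scheme.Modules.pullback (pullback.map A'.X.hom D'.hat.X.hom A.X.hom D.hat.X.hom G Ĝ f wG wĜ)).obj D.P ≅ D'.P)
    (Θ' : CartierDivisor (A'.fibre s').toAbelianVariety.X.left) (hΘ' : Θ'.IsAmple)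
    (h' : A'.IsLambdaOfAt s' D' lam' Θ') :
    haveI : IsDominant (AbelianVariety.Hom.toSchemeHom e.inv) := AbelianVariety.isDominant_toSchemeHom_iso_hom e.symm
    (Θ'.pullback (AbelianVariety.Hom.toSchemeHom e.inv)).IsAmple ∧
      A.IsLambdaOfAt (s' ≫ f) D lam (Θ'.pullback (AbelianVariety.Hom.toSchemeHom e.inv)) := by
  haveI : IsIso (AbelianVariety.Hom.toSchemeHom e.inv) :=
    ⟨AbelianVariety.Hom.toSchemeHom e.hom, A.toSchemeHom_inv_comp_hom A' f s' e, A.toSchemeHom_hom_comp_inv A' f s' e⟩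
  exact ⟨hΘ'.pullback _,
    IsLambdaOfAt.of_isBaseChangeVia_fibreIso_symm A D lam A' D' lam' f G Ĝ wG wĜ hlam s' e he eP Θ' h'⟩

end Square

end AbelianSchemeOver

/-! ### §T′ For the tree's triples and the relation `PolarizedAbelianSchemeWithLevel.IsBaseChangeVia` -/

namespace PolarizedAbelianSchemeWithLevel

open AbelianSchemeOver

variable {g N : ℕ} {δ : Fin g → ℕ} {S T : Scheme.{u}} {P' : PolarizedAbelianSchemeWithLevel g N δ T}
  {P : PolarizedAbelianSchemeWithLevel g N δ S} {f : T ⟶ S} {G : P'.A.X.left ⟶ P.A.X.left}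
  {Ĝ : P'.D.hat.X.left ⟶ P.D.hat.X.left} {L : Type u} [Field L] (s' : Spec (.of L) ⟶ T)
  (e : (P'.A.fibre s').toAbelianVariety ≅ (P.A.fibre (s' ≫ f)).toAbelianVariety)
  (he : AbelianVariety.Hom.toSchemeHom e.hom ≫ pullback.fst P.A.X.hom (s' ≫ f) = pullback.fst P'.A.X.hom s' ≫ G)

include he in
/-- **`λ̄ = Λ(𝒪(Θ))` at `s′ ≫ f` ⟹ `λ̄′ = Λ(𝒪(e^*Θ))` at `s′`** for a pull-back of triples `P′.IsBaseChangeVia P f G Ĝ` and any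
fibre isomorphism `e` over `G`. [cite: MumfordFogartyKirwan1994, Ch. 7 §2 Definition 7.2 (p. 129)]
[cite: MumfordFogartyKirwan1994, Ch. 6 §2 Definition 6.2–6.3 (p. 120)] -/
theorem IsBaseChangeVia.isLambdaOfAt_of_fibreIso (h : P'.IsBaseChangeVia P f G Ĝ)
    (Θ : CartierDivisor (P.A.fibre (s' ≫ f)).toAbelianVariety.X.left) (hΛ : P.A.IsLambdaOfAt (s' ≫ f) P.D P.pol.lam Θ) :
    haveI := AbelianVariety.isDominant_toSchemeHom_iso_hom e
    P'.A.IsLambdaOfAt s' P'.D P'.pol.lam (Θ.pullback (AbelianVariety.Hom.toSchemeHom e.hom)) := by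
  obtain ⟨-, -, ⟨wG, wĜ, ⟨eP⟩⟩, hlam⟩ := h
  exact IsLambdaOfAt.of_isBaseChangeVia_fibreIso P.A P.D P.pol.lam P'.A P'.D P'.pol.lam f G Ĝ wG wĜ hlam s' e he eP Θ hΛ

include he in
/-- **`λ̄′ = Λ(𝒪(Θ′))` at `s′` ⟹ `λ̄ = Λ(𝒪((e⁻¹)^*Θ′))` at `s′ ≫ f`** for a pull-back of triples.
[cite: MumfordFogartyKirwan1994, Ch. 7 §2 Definition 7.2 (p. 129)] [cite: MumfordFogartyKirwan1994, Ch. 6 §2 Definition 6.2–6.3 (p. 120)] -/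
theorem IsBaseChangeVia.isLambdaOfAt_of_fibreIso_symm (h : P'.IsBaseChangeVia P f G Ĝ)
    (Θ' : CartierDivisor (P'.A.fibre s').toAbelianVariety.X.left) (hΛ' : P'.A.IsLambdaOfAt s' P'.D P'.pol.lam Θ') :
    haveI : IsDominant (AbelianVariety.Hom.toSchemeHom e.inv) := AbelianVariety.isDominant_toSchemeHom_iso_hom e.symm
    P.A.IsLambdaOfAt (s' ≫ f) P.D P.pol.lam (Θ'.pullback (AbelianVariety.Hom.toSchemeHom e.inv)) := by
  obtain ⟨-, -, ⟨wG, wĜ, ⟨eP⟩⟩, hlam⟩ := h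
  exact IsLambdaOfAt.of_isBaseChangeVia_fibreIso_symm P.A P.D P.pol.lam P'.A P'.D P'.pol.lam f G Ĝ wG wĜ hlam s' e he eP
    Θ' hΛ'

include he in
/-- **The `hpol` input of ★ (T2) `of_fibreIso` for a pull-back of triples**: ample witnesses of `λ̄′` at `s′` pull back along
`e⁻¹` to ample witnesses of `λ̄` at `s′ ≫ f`. [cite: Lan2013PELCompactifications, §1.3.6 Lemma 1.3.6.6 (pp. 81–82)]
[cite: MumfordFogartyKirwan1994, Ch. 7 §2 Definition 7.2 (p. 129)] -/
theorem IsBaseChangeVia.transfer_of_fibreIso (h : P'.IsBaseChangeVia P f G Ĝ)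
    (Θ' : CartierDivisor (P'.A.fibre s').toAbelianVariety.X.left) (hΘ' : Θ'.IsAmple)
    (hΛ' : P'.A.IsLambdaOfAt s' P'.D P'.pol.lam Θ') :
    haveI : IsDominant (AbelianVariety.Hom.toSchemeHom e.inv) := AbelianVariety.isDominant_toSchemeHom_iso_hom e.symm
    (Θ'.pullback (AbelianVariety.Hom.toSchemeHom e.inv)).IsAmple ∧
      P.A.IsLambdaOfAt (s' ≫ f) P.D P.pol.lam (Θ'.pullback (AbelianVariety.Hom.toSchemeHom e.inv)) := by
  obtain ⟨-, -, ⟨wG, wĜ, ⟨eP⟩⟩, hlam⟩ := h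
  exact transfer_of_isBaseChangeVia_fibreIso P.A P.D P.pol.lam P'.A P'.D P'.pol.lam f G Ĝ wG wĜ hlam s' e he eP Θ' hΘ' hΛ'

end PolarizedAbelianSchemeWithLevel

end Literature.AlgebraicGeometry.AbelianSchemes
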